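import Summits.BirchSwinnertonDyer.BirchSwinnertonDyer.Theorems.EisensteinPrimesBSDpOnCellCTelescopeBranchFrobeniusConjOfCharpoly
import Literature.NumberTheory.EllipticCurves.OrdinaryNewformDatumSelfDualTwist
import HarnessLib

/-!
# [telescope — width x2-p2 g24, 2026-08-30] THE MEMBER FIBRE CLAUSE (U-fib_t) FROM FROBENIUS DATA: if the specialisation `τ = π mod (X − x_t)` of a
# branch lattice has the SAME Frobenius characteristic polynomials as the member datum `(D t).Δ.ρ` off a finite set of places — i.e. Hida's
# (2.1a,b) «unramified outside `Np`, `det(1 − π(σ_ℓ)X) = 1 − a(ℓ)X + ψ(ℓ)ℓ^{k−1}X²`», which is EXACTLY the clause `OrdinaryNewformDatum.charpoly`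
# the tree records for `Δ.ρ` — and both are semisimple over `Ω`, then `τ` is conjugate OVER `Ω` to `Δ.ρ`: rider TU-ident / step (D7) of T-An-2ᴴ
# DISCHARGED down to its semisimplicity inputs (Ribet)
# Crux 4 `BSDpOnCellC` (stmt-BirchSwinnertonDyer-19034), line «telescope» (`--supports`, helper; closes nothing)

WHY: T-An-2ᴴ (U-fib_t) says «`(π σ)(x_t)` conjugate over `Ω = ℂ_p` to `(D t).Δ.ρ`»; print (Hida 1986 Thm 2.1 (2.2c)) says «equivalent to `π(f_{P_t})`»,
the representation CHARACTERISED by (2.1a,b). The identification `π(f_{P_t}) ≅ Δ.ρ ⊗ Ω` is rider TU-ident = Chebotarev + Brauer–Nesbitt + irreducibility.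
With p773985 (Chebotarev transfer) and p774396 (conjugacy from characteristic polynomials, via the tree's PROVED Brauer–Nesbitt), THIS FILE states the
member clause in (2.1a,b) currency: `exists_conjOver_of_hasFrobCharpolyAt` — for `τ : Γ_ℚ →ₜ* GL₂(ℤ_p)` and `Δ : OrdinaryNewformDatum g p ι`, equal
Frobenius characteristic polynomials off a finite `S` (those of `τ` in `ℤ_p[X]`, read in `𝒪_t[X]`) and semisimplicity of both over a topological field
`Ω` of characteristic `0` receiving `𝒪_t` continuously give `P ∈ GL₂(Ω)` with `τ^Ω = P · Δ.ρ^Ω · P⁻¹` — the (U-fib_t) conjugacy of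
`IsUntwistedBranchGaloisLattice` / the `hfibt` input of `TelescopeBranchLatticeOfUntwisted.exists_isBranchGaloisLattice_of_untwisted_eval_conjOver`.
Ingredient proved here: the open ideals of `𝒪_t = padicCoeffIntegers ι` separate points (`padicCoeffIntegers_separating`: the balls `{‖y‖ < r}` are open
ideals), so p773985/p774396 apply over `A := 𝒪_t` after base-changing `τ` along `ℤ_p → 𝒪_t`.

CONTENT (namespace `…Theorems.TelescopeBranchMemberFibreOfFrobCharpoly`; THEOREMS ONLY): `isOpen_ballIdeal`-type lemma `exists_open_ideal_not_mem`,
`padicCoeffIntegers_separating`, **`exists_conjOver_of_hasFrobCharpolyAt`**.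

HONEST FRAMING: representation theory over binders; the semisimplicity inputs (Ribet 1977 Thm. 2.3 for the member, and for the specialisation) remain
HYPOTHESES; constructs no lattice; closes no registered stub, no crux, no summit statement; BSD is proved for no curve by this file. No named fact, no
definition, no instance, no `sorry`.
References (shape only): [cite: Hida1986, §2 (2.1a) (2.1b), Thm. 2.1 (2.2c) (p. 557)] [cite: SerreAbelianLadic1968, Ch. I §2.3] [cite: Ribet1977, Thm. 2.3]
-/

set_option autoImplicit false
set_option linter.dupNamespace false

noncomputable section

open scoped Classical MatrixGroups
open IsDedekindDomain NumberField Field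
open Literature.NumberTheory.GaloisRepresentations Literature.NumberTheory.EllipticCurves Literature.NumberTheory.EllipticCurves.GreenbergSelmer
  Literature.NumberTheory.EllipticCurves.ModularForms
  Summit.BirchSwinnertonDyer.BirchSwinnertonDyer.Theorems.TelescopeBranchFrobeniusCharpolyTransfer
  Summit.BirchSwinnertonDyer.BirchSwinnertonDyer.Theorems.TelescopeBranchFrobeniusConjOfCharpoly

namespace Summit.BirchSwinnertonDyer.BirchSwinnertonDyer.Theorems.TelescopeBranchMemberFibreOfFrobCharpoly

universe w

variable {p : ℕ} [Fact p.Prime] {M' : ℕ} {k' : ℤ} {g' : CuspForm (CongruenceSubgroup.Gamma0 M') k'} (ι' : coeffField g' →+* PadicAlgCl p)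

/-- **The open ideals of `𝒪_t = padicCoeffIntegers ι` separate points**: for `x ≠ 0` the ball `{y : ‖y‖ < ‖x‖}` is an open ideal of `𝒪_t`
(ultrametric) missing `x`. [folklore] -/
theorem padicCoeffIntegers_separating (x : padicCoeffIntegers ι')
    (hx : ∀ I : Ideal (padicCoeffIntegers ι'), IsOpen (I : Set (padicCoeffIntegers ι')) → x ∈ I) : x = 0 := by
  by_contra h0
  -- the norm of `x` read in `ℚ̄_p`
  set r : ℝ := ‖((x : padicCoeffField ι') : PadicAlgCl p)‖ with hr
  have hr0 : 0 < r := by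
    rw [hr, norm_pos_iff]
    intro h
    apply h0
    have h1 : (x : padicCoeffField ι') = 0 := by exact_mod_cast h
    exact_mod_cast h1
  -- the ball of radius `r` is an open ideal
  let I : Ideal (padicCoeffIntegers ι') :=
    { carrier := {y | ‖((y : padicCoeffField ι') : PadicAlgCl p)‖ < r}
      add_mem' := fun {a b} ha hb => by
        change ‖(((a + b : padicCoeffIntegers ι') : padicCoeffField ι') : PadicAlgCl p)‖ < r
        rw [show (((a + b : padicCoeffIntegers ι') : padicCoeffField ι') : PadicAlgCl p) =
          ((a : padicCoeffField ι') : PadicAlgCl p) + ((b : padicCoeffField ι') : PadicAlgCl p) by push_cast; rfl]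
        exact (IsUltrametricDist.norm_add_le_max _ _).trans_lt (max_lt ha hb)
      zero_mem' := by
        change ‖(((0 : padicCoeffIntegers ι') : padicCoeffField ι') : PadicAlgCl p)‖ < r
        simpa using hr0
      smul_mem' := fun c {y} hy => by
        change ‖(((c * y : padicCoeffIntegers ι') : padicCoeffField ι') : PadicAlgCl p)‖ < r
        rw [show (((c * y : padicCoeffIntegers ι') : padicCoeffField ι') : PadicAlgCl p) =
          ((c : padicCoeffField ι') : PadicAlgCl p) * ((y : padicCoeffField ι') : PadicAlgCl p) by push_cast; rfl, norm_mul]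
        exact (mul_le_of_le_one_left (norm_nonneg _) ((mem_padicCoeffIntegers_iff ι' _).mp c.2)).trans_lt hy }
  have hIopen : IsOpen (I : Set (padicCoeffIntegers ι')) := by
    have hc : Continuous fun y : padicCoeffIntegers ι' => ((y : padicCoeffField ι') : PadicAlgCl p) :=
      continuous_subtype_val.comp continuous_subtype_val
    exact (isOpen_lt (continuous_norm.comp hc) continuous_const)
  have hxI := hx I hIopen
  exact lt_irrefl r hxI

set_option maxHeartbeats 800000 in
/-- **The member fibre clause (U-fib_t) from Hida's (2.1a,b).** Let `τ : Γ_ℚ →ₜ* GL₂(ℤ_p)` (the specialisation `π mod (X − x_t)` of a branch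
lattice) and `Δ : OrdinaryNewformDatum g p ι` (`𝒪 = padicCoeffIntegers ι`). Suppose that off a finite set `S` of places, `τ` has Frobenius
characteristic polynomial `Q_v ∈ ℤ_p[X]` and `Δ.ρ` has Frobenius characteristic polynomial `Q_v` read in `𝒪[X]` (for `v ∤ Mp` the latter is the
datum's clause `OrdinaryNewformDatum.charpoly`: `X² − ι(a_ℓ(g))X + ℓ^{k−1}`). Let `f : 𝒪 → Ω` be a continuous ring map to a topological field of
characteristic `0` (e.g. `Ω = ℂ_p`) such that both `τ ⊗ Ω` and `Δ.ρ ⊗ Ω` are semisimple. THEN `τ^Ω = P · (Δ.ρ)^Ω · P⁻¹` for some `P ∈ GL₂(Ω)` —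
the conjugacy OVER `Ω` that `IsUntwistedBranchGaloisLattice` (U-fib_t) asks for, with `τ` read along `f ∘ (ℤ_p → 𝒪)`.
[cite: Hida1986, §2 (2.1a) (2.1b), Thm. 2.1 (2.2c) (p. 557)] [cite: SerreAbelianLadic1968, Ch. I §2.3] -/
theorem exists_conjOver_of_hasFrobCharpolyAt (Δ : OrdinaryNewformDatum g' p ι') (τ : FramedGaloisRep ℚ ℤ_[p] 2)
    (S : Set (HeightOneSpectrum (𝓞 ℚ))) (hS : S.Finite)
    (h : ∀ v : HeightOneSpectrum (𝓞 ℚ), v ∉ S → ∃ Q : Polynomial ℤ_[p],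
      τ.HasFrobCharpolyAt v Q ∧ Δ.ρ.HasFrobCharpolyAt v (Q.map (algebraMap ℤ_[p] (padicCoeffIntegers ι'))))
    {Ω : Type w} [Field Ω] [TopologicalSpace Ω] [IsTopologicalRing Ω] [CharZero Ω]
    (f : padicCoeffIntegers ι' →+* Ω) (hf : Continuous f)
    (hssτ : (FramedRep.toRepresentation (FramedRep.baseChange f hf
      (FramedRep.baseChange (algebraMap ℤ_[p] (padicCoeffIntegers ι')) (padicCoeffIntegers.continuous_algebraMap_padicInt ι') τ))).IsSemisimpleRepresentation)
    (hssΔ : (FramedRep.toRepresentation (FramedRep.baseChange f hf Δ.ρ)).IsSemisimpleRepresentation) :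
    ∃ P : GL (Fin 2) Ω, ∀ σ : absoluteGaloisGroup ℚ,
      (((τ σ : GL (Fin 2) ℤ_[p]) : Matrix (Fin 2) (Fin 2) ℤ_[p]).map (fun z : ℤ_[p] => f (algebraMap ℤ_[p] (padicCoeffIntegers ι') z))) =
        ((P : GL (Fin 2) Ω) : Matrix (Fin 2) (Fin 2) Ω) *
          (((Δ.ρ σ : GL (Fin 2) (padicCoeffIntegers ι')) : Matrix (Fin 2) (Fin 2) (padicCoeffIntegers ι')).map f) *
          ((P⁻¹ : GL (Fin 2) Ω) : Matrix (Fin 2) (Fin 2) Ω) := by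
  set a := algebraMap ℤ_[p] (padicCoeffIntegers ι') with ha
  have hac : Continuous a := padicCoeffIntegers.continuous_algebraMap_padicInt ι'
  set τ' : FramedGaloisRep ℚ (padicCoeffIntegers ι') 2 := FramedRep.baseChange a hac τ with hτ'
  -- Frobenius data of `τ'` and `Δ.ρ` agree off `S`
  have h' : ∀ v : HeightOneSpectrum (𝓞 ℚ), v ∉ S → ∃ P : Polynomial (padicCoeffIntegers ι'),
      Δ.ρ.HasFrobCharpolyAt v P ∧ τ'.HasFrobCharpolyAt v P := by
    intro v hv
    obtain ⟨Q, hQ, hΔ⟩ := h v hv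
    exact ⟨Q.map a, hΔ, FramedGaloisRep.hasFrobCharpolyAt_baseChange a hac hQ⟩
  obtain ⟨P, hP⟩ := exists_conj_baseChange_of_hasFrobCharpolyAt (padicCoeffIntegers_separating ι') Δ.ρ τ' S hS h' f hf hssΔ hssτ
  refine ⟨P, fun σ => ?_⟩
  have hσ := congrArg (fun u : GL (Fin 2) Ω => (u : Matrix (Fin 2) (Fin 2) Ω)) (hP σ)
  simp only [Units.val_mul, FramedRep.coe_baseChange_apply] at hσ
  -- `τ' σ = (τ σ).map a`
  have hτ'σ : ((τ' σ : GL (Fin 2) (padicCoeffIntegers ι')) : Matrix (Fin 2) (Fin 2) (padicCoeffIntegers ι')) =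
      ((τ σ : GL (Fin 2) ℤ_[p]) : Matrix (Fin 2) (Fin 2) ℤ_[p]).map a := FramedRep.coe_baseChange_apply a hac τ σ
  rw [hτ'σ, Matrix.map_map] at hσ
  exact hσ

end Summit.BirchSwinnertonDyer.BirchSwinnertonDyer.Theorems.TelescopeBranchMemberFibreOfFrobCharpoly

end
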